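import Summits.RiemannHypothesis.RiemannHypothesis.Theorems.MotivicDoorDiagonalConstant
import HarnessLib

/-!
# Motivic door (Connes–Consani): the residual archimedean kernel is bounded by `½` (sharp)

Honest framing (cell `pub-rhdoor`, cc-3, verbatim): "lottery ticket at the motivic door; RH
probability negligible; consolation prizes are real: a new semi-local Weil-positivity theorem, or a
located gap in the Connes–Consani programme, plus the ff-door theorem".  No RH content below;
value = theorem.

The residual kernel of the archimedean Weil functional in log-Laplacian form
(`MotivicDoorArchLogLaplacian`: `W_arch(F) = ½𝓔(F) − log(2π)F(0) + ½∫₀^∞ k_r k`,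
`W_arch = weilArchTerm`, `= −W_ℝ` in Bombieri's sign convention) is
`k_r(x) = 1/x − e^{x/2}/sinh x = archResidualKernel x`.  `MotivicDoorArchLogLaplacian` proves
`|k_r| ≤ 5` and records "the true supremum of `|k_r|` is `½`, not proved here";
`MotivicDoorArchResidualSecondOrder` proves `k_r(0⁺) = −½`.  This file proves the sharp global
bound, from the HALF-ANGLE FORM `k_r(x) = 1/x − 1/(2 sinh(x/2)) − 1/(2 cosh(x/2))`
(`e^{x/2} = cosh(x/2) + sinh(x/2)`, `sinh x = 2 sinh(x/2) cosh(x/2)`): the first two terms give a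
number in `[0, ½)` (`sinh y ≥ y`, and `(1−y) sinh y ≤ y`), the last one a number in `(−½, 0)`.

PROVED (RH-free, elementary):
* `archResidualKernel_eq_half_angle`: the half-angle form (`x ≠ 0`).
* `neg_half_lt_archResidualKernel`, `archResidualKernel_lt_half`, `archResidualKernel_lt_inv`,
  `abs_archResidualKernel_le_half`: `−½ < k_r(x) < min(½, 1/x)` for `x > 0`; with `k_r(0⁺) = −½`
  the constant `½` is sharp.
* Sharpened constants (`5 ↦ ½`, `5/2 ↦ ¼`) in the three residual estimates of the door:
  `norm_archResidual_le_quarter` (`‖½∫₀^∞ k_r k‖ ≤ ¼∫₀^∞‖k‖`),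
  `norm_weilArchTermBombieri_sub_logLaplacian_le_quarter`
  (`‖W_arch(F) − (½𝓔(F) − log(2π)F(0))‖ ≤ ¼∫₀^∞‖k‖`: "`W_arch` = ½ log-Laplacian + O(¼‖k‖₁)"),
  `norm_archResidual_comp_mul_le_quarter` (`‖½∫₀^∞ k_r(x)k(Ex)dx‖ ≤ (4E)⁻¹∫₀^∞‖k‖`), and for the
  decreed diagonal (`MotivicDoorDiagonalAsymptotics` (iii) with `5/2 ↦ ¼`):
  `abs_two_mul_ccPairing_approxDiagonal_add_le_quarter`:
  `|2𝔰(f_E,f_E) + ‖u‖₂² E log E + c(u) E| ≤ ¼∫₀^∞‖k_u‖`, uniformly in `E = 1+η ≥ 2R/log 2`.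

References: Bombieri 2000 (Thm 2); Connes, arXiv:1509.05576 §4.1; Connes–Consani,
arXiv:1805.10501 §3.
-/

noncomputable section

set_option linter.dupNamespace false

open Complex Set MeasureTheory Filter Topology Literature.NumberTheory.LFunctions
open Literature.NumberTheory.ConnesConsani2019
open Summit.RiemannHypothesis.RiemannHypothesis.Theorems.MotivicDoor.ArchLogLaplacian

namespace Summit.RiemannHypothesis.RiemannHypothesis.Theorems.MotivicDoor.ConnesConsani

/-! ## 1. The half-angle form and the sharp bound -/

section Kernel

/-- **Half-angle form** of the residual kernel: `k_r(x) = 1/x − 1/(2 sinh(x/2)) − 1/(2 cosh(x/2))`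
(`x ≠ 0`).  PROVED. -/
theorem archResidualKernel_eq_half_angle {x : ℝ} (hx : x ≠ 0) :
    archResidualKernel x = 1 / x - 1 / (2 * Real.sinh (x / 2)) - 1 / (2 * Real.cosh (x / 2)) := by
  have hs : Real.sinh (x / 2) ≠ 0 := Real.sinh_ne_zero.2 (by positivity)
  have hc : Real.cosh (x / 2) ≠ 0 := (Real.cosh_pos _).ne'
  have h2 : Real.sinh x = 2 * Real.sinh (x / 2) * Real.cosh (x / 2) := by
    rw [← Real.sinh_two_mul]; congr 1; ring
  have he : Real.exp (x / 2) = Real.cosh (x / 2) + Real.sinh (x / 2) := (Real.cosh_add_sinh _).symm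
  unfold archResidualKernel
  rw [h2, he]
  field_simp
  ring

/-- `(1 − y) sinh y ≤ y` for `0 ≤ y` (for `y < 1`: `sinh y ≤ eʸ − 1` and `(1 − y)eʸ ≤ 1`). -/
theorem one_sub_mul_sinh_le_self {y : ℝ} (hy : 0 ≤ y) : (1 - y) * Real.sinh y ≤ y := by
  rcases le_or_gt 1 y with h1 | h1
  · have hs : 0 ≤ Real.sinh y := Real.sinh_nonneg_iff.2 hy
    nlinarith
  · have hsinh : Real.sinh y ≤ Real.exp y - 1 := by
      have := Real.one_le_cosh y
      rw [← Real.exp_sub_cosh]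
      linarith
    have hexp : (1 - y) * Real.exp y ≤ 1 := by
      have h := mul_le_mul_of_nonneg_right (Real.one_sub_le_exp_neg y) (Real.exp_pos y).le
      rwa [← Real.exp_add, neg_add_cancel, Real.exp_zero] at h
    nlinarith [mul_le_mul_of_nonneg_left hsinh (by linarith : (0 : ℝ) ≤ 1 - y)]

/-- **`k_r > −½`** on `(0, ∞)`.  PROVED. -/
theorem neg_half_lt_archResidualKernel {x : ℝ} (hx : 0 < x) : -(1 / 2) < archResidualKernel x := by
  rw [archResidualKernel_eq_half_angle hx.ne']
  have hs : x / 2 ≤ Real.sinh (x / 2) := Real.self_le_sinh_iff.2 (by positivity)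
  have hs0 : 0 < Real.sinh (x / 2) := Real.sinh_pos_iff.2 (by positivity)
  have hc : 1 < Real.cosh (x / 2) := Real.one_lt_cosh.2 (by positivity)
  have h1 : 1 / (2 * Real.sinh (x / 2)) ≤ 1 / x := by
    rw [div_le_div_iff₀ (by positivity) hx]; linarith
  have h2 : 1 / (2 * Real.cosh (x / 2)) < 1 / 2 := by
    rw [div_lt_div_iff₀ (by positivity) two_pos]; linarith
  linarith

/-- **`k_r < ½`** on `(0, ∞)`.  PROVED. -/
theorem archResidualKernel_lt_half {x : ℝ} (hx : 0 < x) : archResidualKernel x < 1 / 2 := by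
  rw [archResidualKernel_eq_half_angle hx.ne']
  have hs0 : 0 < Real.sinh (x / 2) := Real.sinh_pos_iff.2 (by positivity)
  have hc0 : 0 < Real.cosh (x / 2) := Real.cosh_pos _
  -- `1/x − 1/(2 sinh(x/2)) ≤ ½`, i.e. `(1 − y) sinh y ≤ y` with `y = x/2`
  have h1 : 1 / x - 1 / (2 * Real.sinh (x / 2)) ≤ 1 / 2 := by
    have h := one_sub_mul_sinh_le_self (by positivity : (0 : ℝ) ≤ x / 2)
    rw [div_sub_div _ _ hx.ne' (by positivity), div_le_div_iff₀ (by positivity) two_pos]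
    nlinarith
  have h2 : 0 < 1 / (2 * Real.cosh (x / 2)) := by positivity
  linarith

/-- `k_r(x) < 1/x` on `(0, ∞)`.  PROVED. -/
theorem archResidualKernel_lt_inv {x : ℝ} (hx : 0 < x) : archResidualKernel x < 1 / x := by
  rw [archResidualKernel_eq_half_angle hx.ne']
  have hs0 : 0 < Real.sinh (x / 2) := Real.sinh_pos_iff.2 (by positivity)
  have h1 : 0 < 1 / (2 * Real.sinh (x / 2)) := by positivity
  have h2 : 0 < 1 / (2 * Real.cosh (x / 2)) := by positivity
  linarith

/-- **`|k_r| ≤ ½` on `(0, ∞)`, sharp** (`k_r(0⁺) = −½`, `tendsto_archResidualKernel_nhdsGT_zero`);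
sharpens `abs_archResidualKernel_le` (`≤ 5`).  PROVED. -/
theorem abs_archResidualKernel_le_half {x : ℝ} (hx : 0 < x) : |archResidualKernel x| ≤ 1 / 2 :=
  abs_le.2 ⟨(neg_half_lt_archResidualKernel hx).le, (archResidualKernel_lt_half hx).le⟩

end Kernel

/-! ## 2. Sharpened constants in the residual estimates -/

section Residual

variable {F : ℝ → ℂ}

/-- `‖½∫₀^∞ k_r k‖ ≤ ¼∫₀^∞‖k‖` (`k = weilSymm F`); sharpens `norm_archResidual_le` (`5/2`).
PROVED. -/
theorem norm_archResidual_le_quarter (hF : IsWeilTest F) :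
    ‖(1 / 2 : ℂ) * ∫ x in Ioi (0 : ℝ), (archResidualKernel x : ℂ) * weilSymm F x‖ ≤
      1 / 4 * ∫ x in Ioi (0 : ℝ), ‖weilSymm F x‖ := by
  have hk : IsWeilTest (weilSymm F) := hF.weilSymm
  have hint : IntegrableOn (fun x ↦ weilSymm F x) (Ioi (0 : ℝ)) :=
    (hk.1.continuous.integrable_of_hasCompactSupport hk.2).integrableOn
  have h2 : ‖∫ x in Ioi (0 : ℝ), (archResidualKernel x : ℂ) * weilSymm F x‖ ≤
      ∫ x in Ioi (0 : ℝ), 1 / 2 * ‖weilSymm F x‖ := by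
    refine (norm_integral_le_integral_norm _).trans ?_
    refine setIntegral_mono_on (integrableOn_archResidualKernel_mul hk).norm
      (hint.norm.const_mul _) measurableSet_Ioi fun x hx ↦ ?_
    rw [norm_mul, Complex.norm_real, Real.norm_eq_abs]
    exact mul_le_mul_of_nonneg_right (abs_archResidualKernel_le_half hx) (norm_nonneg _)
  rw [integral_const_mul] at h2
  rw [norm_mul, show ‖(1 / 2 : ℂ)‖ = 1 / 2 by simp]
  linarith

/-- **"`W_arch` = ½ log-Laplacian + O(¼‖k‖₁)"**:
`‖W_arch(F) − (½𝓔(F) − log(2π)F(0))‖ ≤ ¼∫₀^∞‖k‖` (Bombieri's form `weilArchTermBombieri`,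
`= weilArchTerm` on Weil tests); sharpens `norm_weilArchTermBombieri_sub_logLaplacian_le`.
PROVED. -/
theorem norm_weilArchTermBombieri_sub_logLaplacian_le_quarter (hF : IsWeilTest F) :
    ‖weilArchTermBombieri F -
        ((1 / 2 : ℂ) * logLaplacianEnergy F - (Real.log (2 * Real.pi) : ℂ) * F 0)‖ ≤
      1 / 4 * ∫ x in Ioi (0 : ℝ), ‖weilSymm F x‖ := by
  rw [weilArchTermBombieri_eq_logLaplacian hF, add_sub_cancel_left]
  exact norm_archResidual_le_quarter hF

/-- `‖½∫₀^∞ k_r(x) k(Ex) dx‖ ≤ (4E)⁻¹∫₀^∞‖k‖` (`E > 0`); sharpens `norm_archResidual_comp_mul_le`.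
PROVED. -/
theorem norm_archResidual_comp_mul_le_quarter (hF : IsWeilTest F) {E : ℝ} (hE : 0 < E) :
    ‖(1 / 2 : ℂ) * ∫ x in Ioi (0 : ℝ), (archResidualKernel x : ℂ) * weilSymm F (E * x)‖ ≤
      1 / (4 * E) * ∫ x in Ioi (0 : ℝ), ‖weilSymm F x‖ := by
  have h := norm_archResidual_le_quarter (hF.comp_mul hE.ne')
  simp only [weilSymm_comp_mul_eq] at h
  have hI : ∫ x in Ioi (0 : ℝ), ‖weilSymm F (E * x)‖ =
      E⁻¹ * ∫ x in Ioi (0 : ℝ), ‖weilSymm F x‖ := by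
    have := integral_comp_mul_left_Ioi (fun x ↦ ‖weilSymm F x‖) 0 hE
    rw [mul_zero] at this; rw [this, smul_eq_mul]
  rw [hI] at h
  exact h.trans (le_of_eq (by field_simp))

end Residual

/-! ## 3. The decreed diagonal: the `O(1)` term is at most `¼‖k_u‖₁`, uniformly -/

section Diagonal

variable {u : ℝ → ℝ}

/-- **`|2𝔰(f_E,f_E) + ‖u‖₂² E log E + c(u) E| ≤ ¼∫₀^∞‖k_u‖`** for every `E = 1+η` with
`E log 2 ≥ 2R` (`supp u ⊆ [-R, R]`, notation of `MotivicDoorDiagonalConstant`); sharpens the `5/2`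
of `abs_two_mul_ccPairing_approxDiagonal_add_le`.  RH-free, Suzuki-free.  PROVED. -/
theorem abs_two_mul_ccPairing_approxDiagonal_add_le_quarter (hu : IsWeilTest fun t ↦ (u t : ℂ))
    {R : ℝ} (hsupp : tsupport (fun t ↦ (u t : ℂ)) ⊆ Icc (-R) R) {η : ℝ} (hη : -1 < η)
    (hRη : 2 * R ≤ Real.log 2 * (1 + η)) :
    |2 * ccPairing (toMul fun t ↦ (1 + η) * u ((1 + η) * t))
          (toMul fun t ↦ (1 + η) * u ((1 + η) * t)) +
        (∫ t, ‖(u t : ℂ)‖ ^ 2) * ((1 + η) * Real.log (1 + η)) +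
        (1 / 2 * (logLaplacianEnergy
            (weilConv (fun t ↦ (u t : ℂ)) (weilReflect fun t ↦ (u t : ℂ)))).re -
          Real.log (2 * Real.pi) * ∫ t, ‖(u t : ℂ)‖ ^ 2) * (1 + η)| ≤
      1 / 4 * ∫ x in Ioi (0 : ℝ),
        ‖weilSymm (weilConv (fun t ↦ (u t : ℂ)) (weilReflect fun t ↦ (u t : ℂ))) x‖ := by
  have hc : 0 < 1 + η := by linarith
  have hF : IsWeilTest (weilConv (fun t ↦ (u t : ℂ)) (weilReflect fun t ↦ (u t : ℂ))) :=
    hu.weilConv hu.weilReflect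
  rw [two_mul_ccPairing_approxDiagonal_add_eq hu hsupp hη hRη, abs_neg, abs_mul, abs_of_pos hc]
  have h := norm_archResidual_comp_mul_le_quarter hF hc
  have hI : 0 ≤ ∫ x in Ioi (0 : ℝ),
      ‖weilSymm (weilConv (fun t ↦ (u t : ℂ)) (weilReflect fun t ↦ (u t : ℂ))) x‖ :=
    integral_nonneg fun _ ↦ norm_nonneg _
  calc (1 + η) * |((1 / 2 : ℂ) * ∫ x in Ioi (0 : ℝ), (archResidualKernel x : ℂ) *
          weilSymm (weilConv (fun t ↦ (u t : ℂ)) (weilReflect fun t ↦ (u t : ℂ)))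
            ((1 + η) * x)).re|
      ≤ (1 + η) * (1 / (4 * (1 + η)) * ∫ x in Ioi (0 : ℝ),
          ‖weilSymm (weilConv (fun t ↦ (u t : ℂ)) (weilReflect fun t ↦ (u t : ℂ))) x‖) := by
        gcongr
        exact (Complex.abs_re_le_norm _).trans h
    _ = 1 / 4 * ∫ x in Ioi (0 : ℝ),
          ‖weilSymm (weilConv (fun t ↦ (u t : ℂ)) (weilReflect fun t ↦ (u t : ℂ))) x‖ := by
        field_simp

end Diagonal

end Summit.RiemannHypothesis.RiemannHypothesis.Theorems.MotivicDoor.ConnesConsani
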